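import Mathlib
import HarnessLib.Audit
import Summits.PneNP.PneNP.Theorems.PstarCoincidenceRank

/-!
# Empty-core coincidences are NOR units: the affine-product trichotomy (ROUND-24, O1 at exact tightness; memo g22 §21)

FRONTIER range-avoidance ladder, rung F-N3, ROUND 24 (cell `pnp-ideate`, prover-2 memo `g22/O1-PAIRCORE-g22.md` §19–§21; typed target
`PstarCoreBoundTargets.TerminalPeelable` (p646951); restricted-model proof complexity — nothing here bears on `P` versus `NP`).

`PstarCoincidenceRank` used the rank-six rigidity theorem.  The FULL rank-rigidity classification of the tree
(`PstarRankRigidityFour.classification`: a quadratic `g` vanishing on `Z(q)` is `0`, `q`, an affine product up to adding `q`, or — when `Z(q)` is a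
codimension-two NOR flat — a combination `(μ₁+1)m₁ + (μ₂+1)m₂`) gives the sharp shape of an EMPTY-CORE COINCIDENCE (two G-constraints `e₁, e₂` jointly
unsatisfiable over all assignments, each satisfiable, some assignment violating both):

* **`nor_trichotomy_of_coincidence`** — one of `e₁`, `e₂`, `e₁ ⊕ e₂` is a NOR UNIT: `gfn e₁ + 1`, `gfn e₂ + 1` or `gfn e₁ + gfn e₂ + 1` is a PRODUCT OF
  TWO AFFINE FUNCTIONS on `𝔽₂ⁿ`;
* `gfn_symmDiff` — `gfn (C₁ ∆ C₂, G₁ ∆ G₂, b₁ ⊕ b₂) = gfn e₁ + gfn e₂`;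
* `finrank_le_of_affine_mul` — a G-constraint that is an affine product up to a constant has polar rank `≤ 2` (its polar form IS the symmetric product
  form, `PstarRankRigidityTwo.finrank_le_rad_symForm`);
* **`rank_le_two_of_coincidence`** — hence one of the monomial sets `G₁`, `G₂`, `G₁ ∆ G₂` has adjacency rank `≤ 2`: by `PstarPathRank.star_or_shared_of_rank_two`
  it is empty, a STAR (one AND variable common to all its monomials), or has every AND variable in at least two of its monomials.

For the pair-core chain (`PstarPairCoreNormal`, empty-core branch: `e₁ = (∅, F₁, β)` the AND-sum of an even edge set through the chord, `e₂` the
reader's descendant with monomials `G ∪ F₂`): at maximal sharing a star inside `J₀` is one σ-class and menu monomials on privates have outside partners,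
so the NOR unit is the σσ′-PENDANT mechanism `OR(σᵢ, σⱼ) = 0` — the combinatorial filter "F₁ inside two σ-classes" that reproduces the certificate
j314774 exactly (110 structures with one degenerate chord, 1690 with none; memo §21).  No Assumption A.
-/

set_option linter.dupNamespace false -- `Summit.PneNP.PneNP.…`: summit = sub-problem name (D-0017 single-conjunct layout)

open Finset Module Literature.Computability.Complexity
open scoped symmDiff
open Summit.PneNP.PneNP.Theorems.PstarSALevel (SimpleOverlap)
open Summit.PneNP.PneNP.Theorems.PstarFibrePolys (bit bit_xor bit_injective bit_add_bit_eq_zero_iff)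
open Summit.PneNP.PneNP.Theorems.PstarGapOneAll (gval)
open Summit.PneNP.PneNP.Theorems.PstarGSystemFreeVar (gval_symmDiff)
open Summit.PneNP.PneNP.Theorems.PstarCubeIdeals (IsAffineFn IsQuadFn isAffineFn_of_linear)
open Summit.PneNP.PneNP.Theorems.PstarQuadRank (rad)
open Summit.PneNP.PneNP.Theorems.PstarProductRank (polar)
open Summit.PneNP.PneNP.Theorems.PstarRankRigidityTwo (symForm linPart affine_mul_polar finrank_le_rad_symForm)
open Summit.PneNP.PneNP.Theorems.PstarRankRigidityFour (classification)
open Summit.PneNP.PneNP.Theorems.PstarPathRank (polar_basis star_or_shared_of_rank_two)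
open Summit.PneNP.PneNP.Theorems.PstarGapLinearised (andPair)
open Summit.PneNP.PneNP.Theorems.PstarChordBridge (toBool bit_toBool)
open Summit.PneNP.PneNP.Theorems.PstarCoincidenceRank

namespace Summit.PneNP.PneNP.Theorems.PstarCoincidenceShape

variable {n m : ℕ}

/-! ## Sums of G-constraints and affine products -/
section Tools

variable (I : LocalMap 4 n m)

/-- `gfn` of the symmetric difference is the sum of the `gfn`s. -/
theorem gfn_symmDiff (e₁ e₂ : Finset (Fin n) × Finset (Fin m) × Bool) (x : Fin n → ZMod 2) :
    gfn I (e₁.1 ∆ e₂.1, e₁.2.1 ∆ e₂.2.1, xor e₁.2.2 e₂.2.2) x = gfn I e₁ x + gfn I e₂ x := by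
  classical
  rw [eq_bit_toBool x, gfn_bit, gfn_bit, gfn_bit]
  dsimp only
  rw [gval_symmDiff, bit_xor, bit_xor]
  ring

/-- The polar form of a quadratic function is determined by the function. -/
theorem polar_unique {q : (Fin n → ZMod 2) → ZMod 2} {B B' : LinearMap.BilinForm (ZMod 2) (Fin n → ZMod 2)}
    (hB : ∀ x w, q (x + w) = q x + q w + q 0 + B x w) (hB' : ∀ x w, q (x + w) = q x + q w + q 0 + B' x w) : B = B' := by
  refine LinearMap.ext fun x => LinearMap.ext fun w => ?_
  have h := (hB x w).symm.trans (hB' x w)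
  have key : ∀ s t u : ZMod 2, s + t = s + u → t = u := fun s t u h => by
    have := congrArg (fun r => r - s) h; simpa using this
  exact key _ _ _ h

/-- **An affine product has polar rank at most two**: if `gfn e + κ = μ₁ · μ₂` with `μ₁, μ₂` affine, the adjacency form of the AND pairs of `e` has
radical of codimension `≤ 2`. -/
theorem finrank_le_of_affine_mul {e : Finset (Fin n) × Finset (Fin m) × Bool} {κ : ZMod 2} {μ₁ μ₂ : (Fin n → ZMod 2) → ZMod 2}
    (h₁ : IsAffineFn μ₁) (h₂ : IsAffineFn μ₂) (h : ∀ x, gfn I e x + κ = μ₁ x * μ₂ x) :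
    finrank (ZMod 2) (Fin n → ZMod 2) ≤ finrank (ZMod 2) (rad (polar e.2.1 (fun j => I.vars j 2) (fun j => I.vars j 3))) + 2 := by
  have hbb : ∀ t : ZMod 2, t + t = 0 := by decide
  -- the shifted constraint is quadratic with both polar forms
  have hq : ∀ x w, gfn I e (x + w) + κ = (gfn I e x + κ) + (gfn I e w + κ) + (gfn I e 0 + κ) +
      polar e.2.1 (fun j => I.vars j 2) (fun j => I.vars j 3) x w := fun x w => by
    rw [gfn_add]; linear_combination -(hbb κ)
  have hq' : ∀ x w, gfn I e (x + w) + κ = (gfn I e x + κ) + (gfn I e w + κ) + (gfn I e 0 + κ) + symForm (linPart h₁) (linPart h₂) x w :=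
    fun x w => by rw [h, h, h, h]; exact affine_mul_polar h₁ h₂ x w
  rw [polar_unique (q := fun x => gfn I e x + κ) hq hq']
  exact finrank_le_rad_symForm _ _

end Tools

/-! ## The trichotomy -/
section Shape

variable {I : LocalMap 4 n m}

/-- **EMPTY-CORE COINCIDENCES ARE NOR UNITS** (any instance): `e₁ ∧ e₂` unsatisfiable over all assignments, both satisfiable, and some assignment
violating both.  Then `gfn e₁ + 1`, `gfn e₂ + 1` or `gfn e₁ + gfn e₂ + 1` is a product of two affine functions: `e₁`, `e₂` or
`e₁ ⊕ e₂` holds exactly on the intersection of two affine hyperplanes (or is an affine condition). -/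
theorem nor_trichotomy_of_coincidence {e₁ e₂ : Finset (Fin n) × Finset (Fin m) × Bool}
    (hU : ∀ z : Fin n → Bool, ¬ (gval I e₁.1 e₁.2.1 z = e₁.2.2 ∧ gval I e₂.1 e₂.2.1 z = e₂.2.2))
    (hS₁ : ∃ z : Fin n → Bool, gval I e₁.1 e₁.2.1 z = e₁.2.2) (hS₂ : ∃ z : Fin n → Bool, gval I e₂.1 e₂.2.1 z = e₂.2.2)
    (hD : ∃ z : Fin n → Bool, gval I e₁.1 e₁.2.1 z ≠ e₁.2.2 ∧ gval I e₂.1 e₂.2.1 z ≠ e₂.2.2) :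
    ∃ μ₁ μ₂ : (Fin n → ZMod 2) → ZMod 2, IsAffineFn μ₁ ∧ IsAffineFn μ₂ ∧
      ((∀ x, gfn I e₁ x + 1 = μ₁ x * μ₂ x) ∨ (∀ x, gfn I e₂ x + 1 = μ₁ x * μ₂ x) ∨ (∀ x, gfn I e₁ x + gfn I e₂ x + 1 = μ₁ x * μ₂ x)) := by
  classical
  have hbb : ∀ t : ZMod 2, t + t = 0 := by decide
  set B : LinearMap.BilinForm (ZMod 2) (Fin n → ZMod 2) := polar e₁.2.1 (fun j => I.vars j 2) (fun j => I.vars j 3) with hBdef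
  have hB : ∀ x w, gfn I e₁ (x + w) = gfn I e₁ x + gfn I e₁ w + gfn I e₁ 0 + B x w := gfn_add I e₁
  -- `gfn e₁` is non-constant
  have hq : ∃ v, gfn I e₁ v ≠ gfn I e₁ 0 := by
    obtain ⟨z₁, hz₁⟩ := hS₁
    obtain ⟨z₀, hz₀, -⟩ := hD
    rw [← gfn_bit_eq_zero_iff I e₁] at hz₁
    rw [ne_eq, ← gfn_bit_eq_zero_iff I e₁] at hz₀
    by_cases h0 : gfn I e₁ 0 = 0
    · exact ⟨fun v => bit (z₀ v), by rw [h0]; exact hz₀⟩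
    · exact ⟨fun v => bit (z₁ v), by rw [hz₁]; exact Ne.symm h0⟩
  have hZ : ∀ x : Fin n → ZMod 2, gfn I e₁ x = 0 → gfn I e₂ x + 1 = 0 := by
    intro x hx
    rw [eq_bit_toBool x] at hx ⊢
    rw [gfn_bit_eq_zero_iff] at hx
    have h2 : gfn I e₂ (fun v => bit (toBool (x v))) ≠ 0 := fun h2 => hU _ ⟨hx, (gfn_bit_eq_zero_iff I e₂ _).1 h2⟩
    revert h2
    generalize gfn I e₂ (fun v => bit (toBool (x v))) = t
    revert t; decide
  rcases classification hB hq (isQuadFn_gfn_add_one I e₂) hZ with (h0 | hq') | ⟨μ₁, μ₂, hμ₁, hμ₂, hB'⟩ | ⟨a, b, -, hqab, m₁, m₂, -, -, -⟩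
  · -- `e₂` never holds
    exfalso
    obtain ⟨z, hz⟩ := hS₂
    rw [← gfn_bit_eq_zero_iff I e₂] at hz
    have := h0 (fun v => bit (z v))
    rw [hz, zero_add] at this
    exact one_ne_zero this
  · -- complementary pair: contradicts the doubly-violating assignment
    exfalso
    obtain ⟨z, hz₁, hz₂⟩ := hD
    rw [ne_eq, ← gfn_bit_eq_zero_iff I e₁] at hz₁
    rw [ne_eq, ← gfn_bit_eq_zero_iff I e₂] at hz₂
    have h := hq' (fun v => bit (z v))
    revert h hz₁ hz₂
    generalize gfn I e₂ (fun v => bit (z v)) = s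
    generalize gfn I e₁ (fun v => bit (z v)) = t
    revert s t; decide
  · -- affine product
    refine ⟨μ₁, μ₂, hμ₁, hμ₂, ?_⟩
    rcases hB' with h | h
    · exact Or.inr (Or.inl h)
    · exact Or.inr (Or.inr fun x => by rw [← h x]; ring)
  · -- NOR flat: `gfn e₁ = μ₁ μ₂ + 1`
    refine ⟨fun x => B x b + (gfn I e₁ b + gfn I e₁ 0), fun x => B x a + (gfn I e₁ a + gfn I e₁ 0), ?_, ?_, Or.inl fun x => ?_⟩
    · intro x w
      have := isAffineFn_of_linear (LinearMap.flip B b) (gfn I e₁ b + gfn I e₁ 0) x w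
      simpa only [LinearMap.flip_apply] using this
    · intro x w
      have := isAffineFn_of_linear (LinearMap.flip B a) (gfn I e₁ a + gfn I e₁ 0) x w
      simpa only [LinearMap.flip_apply] using this
    · rw [hqab x]; linear_combination hbb 1

/-- **One of the three monomial sets has adjacency rank at most two.** -/
theorem rank_le_two_of_coincidence {e₁ e₂ : Finset (Fin n) × Finset (Fin m) × Bool}
    (hU : ∀ z : Fin n → Bool, ¬ (gval I e₁.1 e₁.2.1 z = e₁.2.2 ∧ gval I e₂.1 e₂.2.1 z = e₂.2.2))
    (hS₁ : ∃ z : Fin n → Bool, gval I e₁.1 e₁.2.1 z = e₁.2.2) (hS₂ : ∃ z : Fin n → Bool, gval I e₂.1 e₂.2.1 z = e₂.2.2)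
    (hD : ∃ z : Fin n → Bool, gval I e₁.1 e₁.2.1 z ≠ e₁.2.2 ∧ gval I e₂.1 e₂.2.1 z ≠ e₂.2.2) :
    finrank (ZMod 2) (Fin n → ZMod 2) ≤ finrank (ZMod 2) (rad (polar e₁.2.1 (fun j => I.vars j 2) (fun j => I.vars j 3))) + 2 ∨
    finrank (ZMod 2) (Fin n → ZMod 2) ≤ finrank (ZMod 2) (rad (polar e₂.2.1 (fun j => I.vars j 2) (fun j => I.vars j 3))) + 2 ∨
    finrank (ZMod 2) (Fin n → ZMod 2) ≤ finrank (ZMod 2) (rad (polar (e₁.2.1 ∆ e₂.2.1) (fun j => I.vars j 2) (fun j => I.vars j 3))) + 2 := by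
  classical
  obtain ⟨μ₁, μ₂, h₁, h₂, h⟩ := nor_trichotomy_of_coincidence hU hS₁ hS₂ hD
  rcases h with h | h | h
  · exact Or.inl (finrank_le_of_affine_mul I h₁ h₂ h)
  · exact Or.inr (Or.inl (finrank_le_of_affine_mul I h₁ h₂ h))
  · refine Or.inr (Or.inr ?_)
    set e : Finset (Fin n) × Finset (Fin m) × Bool := (e₁.1 ∆ e₂.1, e₁.2.1 ∆ e₂.2.1, xor e₁.2.2 e₂.2.2) with he
    have h' : ∀ x, gfn I e x + 1 = μ₁ x * μ₂ x := fun x => by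
      rw [he, gfn_symmDiff]; exact h x
    have hr := finrank_le_of_affine_mul I h₁ h₂ h'
    rw [he] at hr
    exact hr

/-- **Combinatorial reading**: a monomial set `P` of adjacency rank `≤ 2` is empty, a STAR (one AND variable common to all its monomials), or has
every AND variable in at least two of its monomials. -/
theorem star_or_shared_of_rank_le_two (hI : I.IsPure xorAndPred) (hS : SimpleOverlap I) {P : Finset (Fin m)}
    (hrank : finrank (ZMod 2) (Fin n → ZMod 2) ≤ finrank (ZMod 2) (rad (polar P (fun j => I.vars j 2) (fun j => I.vars j 3))) + 2) :
    P = ∅ ∨ (∃ d : Fin n, ∀ j ∈ P, d ∈ andPair I j) ∨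
      (∀ j₀ ∈ P, ∀ s : Fin 4, 2 ≤ s.val → ∃ j ∈ P, j ≠ j₀ ∧ I.vars j₀ s ∈ andPair I j) := by
  classical
  rcases P.eq_empty_or_nonempty with h | ⟨j₀, hj₀⟩
  · exact Or.inl h
  · right
    have hab : polar P (fun j => I.vars j 2) (fun j => I.vars j 3) (Pi.single (I.vars j₀ 2) (1 : ZMod 2)) (Pi.single (I.vars j₀ 3) 1) = 1 := by
      rw [polar_basis I hI hS, if_pos ⟨j₀, hj₀, Or.inl ⟨rfl, rfl⟩⟩]
    exact star_or_shared_of_rank_two hI hS hab hrank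

end Shape

end Summit.PneNP.PneNP.Theorems.PstarCoincidenceShape
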